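import Mathlib
import HarnessLib
import Literature.Analysis.FluidPDE.FirstIntegralTransportDefect
import Summits.NavierStokesRegularity.NavierStokesRegularity.Theorems.PoloidalWindowDoorLrcModEntireQ4SonicHotSheetSecondPins
import Summits.NavierStokesRegularity.NavierStokesRegularity.Theorems.PoloidalWindowDoorLrcModEntireTwistingTHFlatRidgeThirdJet
import Summits.NavierStokesRegularity.NavierStokesRegularity.Theorems.PoloidalWindowDoorLrcModEntireRidgeWebLaw

/-!
# Route `PoloidalWindowDoor`, item `LrcModEntire` (stmt-NavierStokesRegularity-20428), cell (Q4-sonic) of the (TH) column, slot `stub_Q4sonicLineNeg` —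
# THE THIRD-ORDER JET ON THE STRAIGHT HOT SHEET: `D³U₂(−1,·)(W)[e,·,·] = 0` (the web direction `e` kills the whole third derivative)

Cell ns-regularity-ideate, helper seat ns-k2-port-2 g8 under the LEAD of item 20428 (ns-poloidal-K2-p3 g16, pick 2026-08-29T17:01Z «HS2»);
`--supports stmt-NavierStokesRegularity-20428 --as helper`.  Memo `Cruxes/LrcModEntire/T2B-g16-sonic.md` §2(d) («`∂_eθ` vanishes to second order on `Σ`») in
kernel form.  Setting of the residual sonic slot over a STRAIGHT branch: parallel webs `W(s,z) = s·e + d(z)·Je + z·e₂` (`…Q4WebPackage.line_web_package`), every web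
point hot (`…Q4SonicHotSheet`), so (`…Q4SonicHotSheetSecondPins`) the slice Hessian of `θ = U₂(−1,·)` kills the sheet tangents `e` and `d′(z)Je + e₂` at every web point.
Differentiating THAT along the sheet and adding ONE scalar datum — the web direction is critical for the Laplacian, `D(Δθ)(W)[e] = 0`, which at class level is the
ridge law «`Δθ` takes one value at two hot points of one height» (`…RidgeWebLaw.laplacian_two_eq_of_webData`, port-2 g6) — gives the WHOLE slice `D³θ(W)[e,·,·] = 0`:

* Part A (class-free, `θ ∈ C³`): `thirdDeriv_apply_eq_zero_of_hessian_null_sheet` (if `D²θ(W q)[a] = 0` for `q` near `p` then `D³θ(W p)[DW(p)h][a] = 0`);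
  `frame_decomp` (coordinates in the frame `{e, Je, e₂}`); `fderiv_laplacian_apply_eq_sum_thirdDeriv` (`D(Δθ)(y)[w] = ∑ᵢ D³θ(y)[eᵢ][eᵢ][w]`);
  ★ `thirdDeriv_webDirection_eq_zero_of_null` — parallel straight web, `d` differentiable at `p₂`, `D²θ(W q)[e] = 0` for `q` near `p`, `D(Δθ)(W p)[e] = 0`
  ⇒ **`D³θ(W p)[e][b][c] = 0` for all `b, c`** (entries on `span{e, d′Je + e₂}` by differentiating the null direction along the sheet and Schwarz
  `…FlatRidgeThirdJet.thirdDeriv_symm₁₂/₂₃`, the last entry `D³θ[e,Je,Je]` from the trace `D(Δθ)[e] = (1 + d′²)·D³θ[e,Je,Je]`, `…SheetFlattenTools.bilin_frame_trace`);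
  `thirdDeriv_webDirection_eq_zero` — the same from `θ ≤ M`, `θ ∘ W ≡ M` near `p` (`…SecondPins.hessian_webTangent_eq_zero` supplies the null direction).
* Part B (class level, hypotheses = conjuncts of `stub_Q4sonicLineNeg` as consumed by `sonic_web_point_hot` + the slab slope law + `μ(−1,z) ≠ 1`):
  `sonic_sheet_laplacian_webDirection_eq_zero` (`D(ΔU₂(−1,·))(W p)[e] = 0`) and ★★ `sonic_sheet_thirdDeriv_webDirection_eq_zero`
  (**`D³U₂(−1,·)(W p)[e][b][c] = 0` for all `b, c`**): the horizontal derivative `∂_eU₂(−1,·)` vanishes on the sonic sheet together with its full first and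
  second derivatives — the Cauchy data a non-characteristic uniqueness argument across the sheet would start from (the sheet itself is characteristic for the
  slice operator `∂₂² + μΔₕ`; memo §2(c)(i),(d)).

WHAT THIS IS NOT: not a claim about Navier–Stokes regularity — necessary conditions on the hypothetical hot null sheet of the research slot `stub_Q4sonicLineNeg`
(registry twist_split v11); no stub is closed here; items 20428 / 19708 / 27893 OPEN.
-/

noncomputable section

set_option linter.dupNamespace false
set_option linter.style.longLine false

namespace Summit.NavierStokesRegularity.NavierStokesRegularity.Theorems.PoloidalWindowDoorLrcModEntireQ4SonicHotSheetJet

open Set Function Filter Topology Metric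
open scoped RealInnerProductSpace InnerProductSpace Laplacian ContDiff
open Literature.Analysis Literature.Analysis.FluidPDE Literature.Analysis.UnboundedOperators
open Summit.NavierStokesRegularity.NavierStokesRegularity.Theorems
open Summit.NavierStokesRegularity.NavierStokesRegularity.Theorems.LocalSineTubeDoorProfileAlignedWindowRigidityAncient
open Summit.NavierStokesRegularity.NavierStokesRegularity.Theorems.PoloidalWindowDoorLrcModEntireRidgeWiring
open Summit.NavierStokesRegularity.NavierStokesRegularity.Theorems.PoloidalWindowDoorLrcModEntireQ4SonicHotSheet
open Summit.NavierStokesRegularity.NavierStokesRegularity.Theorems.PoloidalWindowDoorLrcModEntireQ4SonicHotSheetSecondPins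
open Summit.NavierStokesRegularity.NavierStokesRegularity.Theorems.PoloidalWindowDoorLrcModEntireTwistingTHHotPointPins
open Summit.NavierStokesRegularity.NavierStokesRegularity.Theorems.PoloidalWindowDoorLrcModEntireTwistingTHFlatRidgeThirdJet
open Summit.NavierStokesRegularity.NavierStokesRegularity.Theorems.PoloidalWindowDoorLrcModEntireSheetFlattenTools
open Summit.NavierStokesRegularity.NavierStokesRegularity.Theorems.PoloidalWindowDoorLrcModEntireParallelWebsIdentity
open Summit.NavierStokesRegularity.NavierStokesRegularity.Theorems.PoloidalWindowDoorLrcModEntireRidgeWebLaw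

/-! ### Part A — class-free -/

section ClassFree

variable {E P : Type*} [NormedAddCommGroup E] [NormedSpace ℝ E] [NormedAddCommGroup P] [NormedSpace ℝ P]

/-- **Differentiating a null direction of the Hessian along a sheet:** `θ ∈ C³`, `W` differentiable at `p`, `D²θ(W q)[a] = 0` (as a linear form) for all `q`
near `p` ⇒ `D³θ(W p)[DW(p)h][a][w] = 0` for all `h`, `w`. -/
theorem thirdDeriv_apply_eq_zero_of_hessian_null_sheet {θ : E → ℝ} (hθ : ContDiff ℝ 3 θ) {W : P → E} {p : P} (hW : DifferentiableAt ℝ W p)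
    {a : E} (hnull : ∀ᶠ q in 𝓝 p, fderiv ℝ (fderiv ℝ θ) (W q) a = 0) (h : P) (w : E) :
    fderiv ℝ (fderiv ℝ (fderiv ℝ θ)) (W p) (fderiv ℝ W p h) a w = 0 := by
  have hD2 : Differentiable ℝ (fderiv ℝ (fderiv ℝ θ)) :=
    ((hθ.fderiv_right (m := 2) (by norm_num)).fderiv_right (m := 1) (by norm_num)).differentiable one_ne_zero
  have hΦ : DifferentiableAt ℝ (fun x => fderiv ℝ (fderiv ℝ θ) x a) (W p) := (hD2 _).clm_apply (differentiableAt_const a)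
  have hcomp : HasFDerivAt (fun q => fderiv ℝ (fderiv ℝ θ) (W q) a)
      ((fderiv ℝ (fun x => fderiv ℝ (fderiv ℝ θ) x a) (W p)).comp (fderiv ℝ W p)) p :=
    hΦ.hasFDerivAt.comp p hW.hasFDerivAt
  have hzero : fderiv ℝ (fun q => fderiv ℝ (fderiv ℝ θ) (W q) a) p = 0 := by
    have hev : (fun q => fderiv ℝ (fderiv ℝ θ) (W q) a) =ᶠ[𝓝 p] fun _ => (0 : E →L[ℝ] ℝ) := hnull
    rw [hev.fderiv_eq]; simp
  have h2 := hcomp.fderiv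
  rw [hzero] at h2
  have h3 := congrArg (fun L : P →L[ℝ] E →L[ℝ] ℝ => L h w) h2
  simp only [zero_apply, ContinuousLinearMap.comp_apply] at h3
  rw [fderiv_apply_const_apply_eq_fderiv_fderiv (hD2 _) (fderiv ℝ W p h) a] at h3
  exact h3.symm

end ClassFree

/-- Coordinates in the horizontal frame: `b = (b₀e₀ + b₁e₁)·e + (b₁e₀ − b₀e₁)·Je + b₂·e₂` for a horizontal unit vector `e`. -/
theorem frame_decomp {e : EuclideanSpace ℝ (Fin 3)} (he2 : e 2 = 0) (hunit : e 0 ^ 2 + e 1 ^ 2 = 1) (b : EuclideanSpace ℝ (Fin 3)) :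
    b = (b 0 * e 0 + b 1 * e 1) • e + (b 1 * e 0 - b 0 * e 1) • Jvec e + b 2 • e2 := by
  ext i
  fin_cases i
  · simp [Jvec, e2]
    linear_combination -(b 0) * hunit
  · simp [Jvec, e2]
    linear_combination -(b 1) * hunit
  · simp [Jvec, e2, he2]

/-- `D(Δθ)(y)[w] = ∑ᵢ D³θ(y)[eᵢ][eᵢ][w]` over the standard basis of `ℝ³`, for `θ` of class `C³` at `y`. -/
theorem fderiv_laplacian_apply_eq_sum_thirdDeriv {θ : EuclideanSpace ℝ (Fin 3) → ℝ} {y : EuclideanSpace ℝ (Fin 3)} (hθ : ContDiffAt ℝ 3 θ y)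
    (w : EuclideanSpace ℝ (Fin 3)) :
    fderiv ℝ (Δ θ) y w = ∑ i : Fin 3, fderiv ℝ (fderiv ℝ (fderiv ℝ θ)) y (EuclideanSpace.single i (1 : ℝ)) (EuclideanSpace.single i (1 : ℝ)) w := by
  rw [← laplacian_fderiv_apply_of_contDiffAt (EuclideanSpace.basisFun (Fin 3) ℝ) hθ w,
    laplacian_eq_sum_fderiv_fderiv_curried (EuclideanSpace.basisFun (Fin 3) ℝ) (fderiv ℝ θ) y]
  simp

/-- ★ **THE WEB DIRECTION KILLS THE THIRD DERIVATIVE (core form).**  `θ ∈ C³`; a horizontal unit vector `e`; a web offset `d`, differentiable at `p₂`; the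
parallel straight web `W(q) = q₁·e + d(q₂)·Je + q₂·e₂`; the web direction is a null direction of the Hessian along the sheet, `D²θ(W q)[e] = 0` for `q` near
`p`; and the scalar datum `D(Δθ)(W p)[e] = 0`.  Then `D³θ(W p)[e][b][c] = 0` for all `b, c`. -/
theorem thirdDeriv_webDirection_eq_zero_of_null {θ : EuclideanSpace ℝ (Fin 3) → ℝ} (hθ : ContDiff ℝ 3 θ)
    {e : EuclideanSpace ℝ (Fin 3)} (he2 : e 2 = 0) (hunit : e 0 ^ 2 + e 1 ^ 2 = 1) {d : ℝ → ℝ} {p : ℝ × ℝ}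
    (hd : DifferentiableAt ℝ d p.2)
    (hnull : ∀ᶠ q in 𝓝 p, fderiv ℝ (fderiv ℝ θ) (webMap e (fun q : ℝ × ℝ => d q.2) q) e = 0)
    (hlap : fderiv ℝ (Δ θ) (webMap e (fun q : ℝ × ℝ => d q.2) p) e = 0) (b c : EuclideanSpace ℝ (Fin 3)) :
    fderiv ℝ (fderiv ℝ (fderiv ℝ θ)) (webMap e (fun q : ℝ × ℝ => d q.2) p) e b c = 0 := by
  set G : ℝ × ℝ → ℝ := fun q => d q.2 with hG
  set y := webMap e G p with hy
  set T := fderiv ℝ (fderiv ℝ (fderiv ℝ θ)) y with hT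
  have hθy : ContDiffAt ℝ 3 θ y := hθ.contDiffAt
  -- symmetries of `D³θ(y)`
  have h12 : ∀ a b c, T a b c = T b a c := fun a b c => thirdDeriv_symm₁₂ hθy a b c
  have h23 : ∀ a b c, T a b c = T a c b := fun a b c => thirdDeriv_symm₂₃ hθy a b c
  -- `G = d ∘ snd`: `DG(p)h = d′(p₂)·h₂`
  have hGp' : HasFDerivAt G ((ContinuousLinearMap.smulRight (1 : ℝ →L[ℝ] ℝ) (deriv d p.2)).comp (ContinuousLinearMap.snd ℝ ℝ ℝ)) p :=
    hd.hasDerivAt.hasFDerivAt.comp p hasFDerivAt_snd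
  have hGp : DifferentiableAt ℝ G p := hGp'.differentiableAt
  have hGapply : ∀ h : ℝ × ℝ, fderiv ℝ G p h = deriv d p.2 * h.2 := by
    intro h
    rw [hGp'.fderiv]
    simp [mul_comm]
  -- STEP 1: the two sheet tangents `e = DW(p)(1,0)` and `d′Je + e₂ = DW(p)(0,1)`
  have hWe : fderiv ℝ (webMap e G) p ((1 : ℝ), (0 : ℝ)) = e := by
    rw [fderiv_webMap_apply e hGp, hGapply]; simp
  have hWz : fderiv ℝ (webMap e G) p ((0 : ℝ), (1 : ℝ)) = deriv d p.2 • Jvec e + e2 := by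
    rw [fderiv_webMap_apply e hGp, hGapply]; simp
  have hWd : DifferentiableAt ℝ (webMap e G) p := (hasFDerivAt_webMap e hGp).differentiableAt
  -- STEP 2: `T[e][e][·] = 0` and `T[d′Je + e₂][e][·] = 0`
  have hTe : ∀ w, T e e w = 0 := by
    intro w
    have h := thirdDeriv_apply_eq_zero_of_hessian_null_sheet hθ hWd hnull ((1 : ℝ), (0 : ℝ)) w
    rwa [hWe] at h
  have hTz : ∀ w, T (deriv d p.2 • Jvec e + e2) e w = 0 := by
    intro w
    have h := thirdDeriv_apply_eq_zero_of_hessian_null_sheet hθ hWd hnull ((0 : ℝ), (1 : ℝ)) w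
    rwa [hWz] at h
  -- STEP 3: all entries in terms of `X = T[e][Je][Je]`
  set k := deriv d p.2 with hk
  have hTz' : ∀ w, k * T e (Jvec e) w + T e e2 w = 0 := by
    intro w
    have h := hTz w
    rw [h12] at h
    simpa [map_add, map_smul] using h
  have hX1 : T e e2 (Jvec e) = -k * T e (Jvec e) (Jvec e) := by linarith [hTz' (Jvec e)]
  have hX1' : T e (Jvec e) e2 = -k * T e (Jvec e) (Jvec e) := by rw [h23]; exact hX1
  have hX2 : T e e2 e2 = k ^ 2 * T e (Jvec e) (Jvec e) := by
    have h := hTz' e2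
    rw [hX1'] at h
    linear_combination h
  -- STEP 4: the trace `D(Δθ)(y)[e] = T[e][e][e] + T[e][Je][Je] + T[e][e₂][e₂] = (1 + k²)·X = 0`
  have htrace : fderiv ℝ (Δ θ) y e = T e e e + T e (Jvec e) (Jvec e) + T e e2 e2 := by
    rw [fderiv_laplacian_apply_eq_sum_thirdDeriv hθy e, Fin.sum_univ_three]
    have hsw : ∀ i : Fin 3, T (EuclideanSpace.single i (1 : ℝ)) (EuclideanSpace.single i (1 : ℝ)) e =
        T e (EuclideanSpace.single i (1 : ℝ)) (EuclideanSpace.single i (1 : ℝ)) := by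
      intro i; rw [h23, h12]
    rw [hsw 0, hsw 1, hsw 2, ← bilin_frame_trace (T e) he2 hunit]
    rfl
  have hX : T e (Jvec e) (Jvec e) = 0 := by
    have h : (1 + k ^ 2) * T e (Jvec e) (Jvec e) = 0 := by
      have h0 := hlap
      rw [htrace, hTe, hX2] at h0
      linear_combination h0
    rcases mul_eq_zero.1 h with h1 | h1
    · nlinarith [sq_nonneg k]
    · exact h1
  -- STEP 5: expand `b`, `c` in the frame `{e, Je, e₂}`
  have hJe : T e (Jvec e) e = 0 := by rw [h23]; exact hTe _
  have hJ2 : T e (Jvec e) e2 = 0 := by rw [hX1', hX]; ring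
  have h2e : T e e2 e = 0 := by rw [h23]; exact hTe _
  have h2J : T e e2 (Jvec e) = 0 := by rw [hX1, hX]; ring
  have h22 : T e e2 e2 = 0 := by rw [hX2, hX]; ring
  rw [frame_decomp he2 hunit b, frame_decomp he2 hunit c]
  simp only [map_add, map_smul, add_apply, smul_apply, smul_eq_mul, hTe, hJe, hX, hJ2, h2e, h2J, h22]
  ring

/-- ★ **THE WEB DIRECTION KILLS THE THIRD DERIVATIVE on a sheet of maxima ruled by parallel lines.**  `θ ∈ C³` with `θ ≤ M`; a horizontal unit vector `e`; a web
offset `d`, differentiable near `p₂`; the parallel straight web `W(q) = q₁·e + d(q₂)·Je + q₂·e₂` with `θ(W q) = M` for `q` near `p`; and the scalar datum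
`D(Δθ)(W p)[e] = 0`.  Then `D³θ(W p)[e][b][c] = 0` for all `b, c`. -/
theorem thirdDeriv_webDirection_eq_zero {θ : EuclideanSpace ℝ (Fin 3) → ℝ} (hθ : ContDiff ℝ 3 θ) {M : ℝ} (hle : ∀ x, θ x ≤ M)
    {e : EuclideanSpace ℝ (Fin 3)} (he2 : e 2 = 0) (hunit : e 0 ^ 2 + e 1 ^ 2 = 1) {d : ℝ → ℝ} {p : ℝ × ℝ}
    (hd : ∀ᶠ z in 𝓝 p.2, DifferentiableAt ℝ d z)
    (hsheet : ∀ᶠ q in 𝓝 p, θ (webMap e (fun q : ℝ × ℝ => d q.2) q) = M)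
    (hlap : fderiv ℝ (Δ θ) (webMap e (fun q : ℝ × ℝ => d q.2) p) e = 0) (b c : EuclideanSpace ℝ (Fin 3)) :
    fderiv ℝ (fderiv ℝ (fderiv ℝ θ)) (webMap e (fun q : ℝ × ℝ => d q.2) p) e b c = 0 := by
  set G : ℝ × ℝ → ℝ := fun q => d q.2 with hG
  have hθ2 : ContDiff ℝ 2 θ := hθ.of_le (by norm_num)
  have hGd : ∀ q : ℝ × ℝ, DifferentiableAt ℝ d q.2 → HasFDerivAt G ((ContinuousLinearMap.smulRight (1 : ℝ →L[ℝ] ℝ) (deriv d q.2)).comp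
      (ContinuousLinearMap.snd ℝ ℝ ℝ)) q := fun q hq => hq.hasDerivAt.hasFDerivAt.comp q hasFDerivAt_snd
  -- `D²θ(W q)[e] = 0` for `q` near `p`: the constant tangent `e = DW(q)(1,0)` is a null direction at every sheet point
  have hd' : ∀ᶠ q : ℝ × ℝ in 𝓝 p, DifferentiableAt ℝ d q.2 := continuousAt_snd.eventually hd
  have hnull : ∀ᶠ q in 𝓝 p, fderiv ℝ (fderiv ℝ θ) (webMap e G q) e = 0 := by
    filter_upwards [hd', hsheet.eventually_nhds] with q hq hq'
    have hGq : DifferentiableAt ℝ G q := (hGd q hq).differentiableAt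
    ext w
    have h := (hessian_webTangent_eq_zero hθ2 hle e hGq hq' ((1 : ℝ), (0 : ℝ)) w).1
    rw [(hGd q hq).fderiv] at h
    simpa using h
  exact thirdDeriv_webDirection_eq_zero_of_null hθ he2 hunit hd.self_of_nhds hnull hlap b c

/-! ### Part B — class level: the straight sonic sheet of the hull element -/

variable {C : ℝ} {U : ℝ → EuclideanSpace ℝ (Fin 3) → EuclideanSpace ℝ (Fin 3)} {Γ νΓ : ℝ → EuclideanSpace ℝ (Fin 3)} {R : ℝ → ℝ → ℝ}
  {σ r δ : ℝ}

/-- **The web direction is critical for the Laplacian on the sonic sheet:** in the sonic cell over a straight branch with parallel web offset `d` (web points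
`W(q) = q₁·e + d(q₂)·Je + q₂·e₂` carrying the ridge height for `q` near `p`, `|p₂| < δ`, `|p₂| < ρ`), the (TH) slab slope law with `μ(−1,p₂) ≠ 1`:
`D(ΔU₂(−1,·))(W p)[e] = 0` — `ΔU₂(−1,·)` takes ONE value at any two hot points of one height (`…RidgeWebLaw.laplacian_two_eq_of_webData` with the hot-point pins
`…TwistingTHHotPointPins.gradPin/timePin_of_hotPoint`), so it is constant along the web line through `W p`. -/
theorem sonic_sheet_laplacian_webDirection_eq_zero (hUrate : HasTypeITimeDecay C U) (hUcont : ContinuousOn (uncurry U) (Iio (0 : ℝ) ×ˢ univ))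
    (hUmild : ∀ s t : ℝ, s < t → t < 0 → ∀ x, U t x = heatExtension (U s) (t - s) x - oseenDuhamel 1 s U U t x)
    (hUdiv : ∀ t < 0, VectorCalculus.IsDivFree (U t))
    (hUpol : ∀ s < 0, ∀ q, ⟪curl (U s) q, EuclideanSpace.single 2 1⟫_ℝ = 0)
    (hUne : U (-1) 0 2 ≠ 0) (hUhotbd : ∀ t < 0, ∀ x, Real.sqrt (-t) * |U t x 2| ≤ |U (-1) 0 2|)
    (hσ : σ = 1 ∨ σ = -1) (hσN : σ * U (-1) 0 2 = |U (-1) 0 2|) (hΓhot : ∀ s, U (-1) (Γ s) 2 = U (-1) 0 2)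
    (hr : 0 < r) (hδ : 0 < δ)
    (hweb : ∀ z₀ : ℝ, |z₀| < δ → ∀ s₀ : ℝ, ∃ n₀ ∈ Ioo (-r) r,
      σ * U (-1) (Γ s₀ + n₀ • νΓ s₀ + z₀ • EuclideanSpace.single 2 (1 : ℝ)) 2 = R 0 z₀ ∧
      (∀ n ∈ Icc (-r) r, n ≠ n₀ → σ * U (-1) (Γ s₀ + n • νΓ s₀ + z₀ • EuclideanSpace.single 2 (1 : ℝ)) 2 < R 0 z₀))
    (hson : ∃ a b : ℝ, ∀ z : ℝ, |z| < δ → R 0 z = a + b * z)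
    {ρ : ℝ} {μ : ℝ → ℝ → ℝ} (hρ : 0 < ρ) (hμ3 : ContDiff ℝ 3 (uncurry μ))
    (hslabU : ∀ t : ℝ, |t + 1| < ρ → ∀ x : EuclideanSpace ℝ (Fin 3), |x 2| < ρ → ∀ b : Fin 3, b ≠ 2 →
      fderiv ℝ (U t) x (EuclideanSpace.single 2 1) b = μ t (x 2) * fderiv ℝ (U t) x (EuclideanSpace.single b 1) 2)
    {e : EuclideanSpace ℝ (Fin 3)} (he2 : e 2 = 0) {d : ℝ → ℝ} {p : ℝ × ℝ} (hp : |p.2| < δ) (hpρ : |p.2| < ρ) (hμ1 : μ (-1) p.2 ≠ 1)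
    (hGval : ∀ᶠ q in 𝓝 p, σ * U (-1) (webMap e (fun q : ℝ × ℝ => d q.2) q) 2 = R 0 q.2) :
    fderiv ℝ (Δ (fun x => U (-1) x 2)) (webMap e (fun q : ℝ × ℝ => d q.2) p) e = 0 := by
  have hm1 : (-1 : ℝ) < 0 := by norm_num
  have hσ0 := sigma_ne_zero hσ
  set G : ℝ × ℝ → ℝ := fun q => d q.2 with hG
  set θ : EuclideanSpace ℝ (Fin 3) → ℝ := fun x => U (-1) x 2 with hθdef
  -- regularity
  have hUan : AnalyticOnNhd ℝ (U (-1)) univ := analyticOnNhd_slice hUcont (bdd_of_hasTypeITimeDecay hUrate) hUmild hm1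
  have hθan : AnalyticOnNhd ℝ θ univ := fun x _ =>
    ((EuclideanSpace.proj (𝕜 := ℝ) (2 : Fin 3)).analyticAt _).comp (hUan x (mem_univ _))
  have hθ3 : ContDiff ℝ 3 θ := hθan.contDiff
  -- heights on the web
  have hW2 : ∀ q : ℝ × ℝ, webMap e G q 2 = q.2 := by
    intro q; simp [webMap, Jvec, e2, he2]
  -- every web point near `p` is a hot point
  have hopen : ∀ᶠ q : ℝ × ℝ in 𝓝 p, |q.2| < δ :=
    (isOpen_lt (continuous_abs.comp continuous_snd) continuous_const).mem_nhds hp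
  have hhot : ∀ᶠ q in 𝓝 p, U (-1) (webMap e G q) 2 = U (-1) 0 2 := by
    filter_upwards [hGval, hopen] with q hq hq2
    have h : σ * U (-1) (webMap e G q) 2 = σ * U (-1) 0 2 := by
      rw [hq, sonic_ridge_height_const hUhotbd hσ hσN hΓhot hr hδ hweb hson q.2 hq2, hσN]
    exact mul_left_cancel₀ hσ0 h
  -- the slope law near the plane `{y₂ = p₂}` at `t = −1`
  have hslope : ∀ y : EuclideanSpace ℝ (Fin 3), y 2 = webMap e G p 2 →
      ∀ᶠ z in 𝓝 (((-1 : ℝ), y) : ℝ × EuclideanSpace ℝ (Fin 3)), ∀ b : Fin 3, b ≠ 2 →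
        fderiv ℝ (U z.1) z.2 (EuclideanSpace.single 2 1) b = μ z.1 (z.2 2) * fderiv ℝ (U z.1) z.2 (EuclideanSpace.single b 1) 2 := by
    intro y hy
    rw [hW2] at hy
    have h1 : ∀ᶠ z : ℝ × EuclideanSpace ℝ (Fin 3) in 𝓝 ((-1 : ℝ), y), |z.1 + 1| < ρ := by
      have hc : Continuous fun z : ℝ × EuclideanSpace ℝ (Fin 3) => |z.1 + 1| := by fun_prop
      exact (isOpen_lt hc continuous_const).mem_nhds (by simp [hρ])
    have h2 : ∀ᶠ z : ℝ × EuclideanSpace ℝ (Fin 3) in 𝓝 ((-1 : ℝ), y), |z.2 2| < ρ := by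
      have hc : Continuous fun z : ℝ × EuclideanSpace ℝ (Fin 3) => |z.2 2| :=
        continuous_abs.comp ((EuclideanSpace.proj (𝕜 := ℝ) (2 : Fin 3)).continuous.comp continuous_snd)
      exact (isOpen_lt hc continuous_const).mem_nhds (by simp [hy, hpρ])
    filter_upwards [h1, h2] with z hz1 hz2
    exact hslabU z.1 hz1 z.2 hz2
  -- `Δθ` is constant along the web line through `W p`: compare the hot points `W(s, p₂)` and `W p`
  have hline : ∀ᶠ s in 𝓝 p.1, (Δ θ) (webMap e G (s, p.2)) = (Δ θ) (webMap e G p) := by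
    have hc : ContinuousAt (fun s : ℝ => ((s, p.2) : ℝ × ℝ)) p.1 := (continuous_id.prodMk continuous_const).continuousAt
    have hhot' : ∀ᶠ s in 𝓝 p.1, U (-1) (webMap e G (s, p.2)) 2 = U (-1) 0 2 := hc.eventually (by simpa using hhot)
    filter_upwards [hhot'] with s hs
    have hp' : U (-1) (webMap e G p) 2 = U (-1) 0 2 := hhot.self_of_nhds
    have hxx' : webMap e G (s, p.2) 2 = webMap e G p 2 := by rw [hW2, hW2]
    have hg := fun (y : EuclideanSpace ℝ (Fin 3)) (hy : U (-1) y 2 = U (-1) 0 2) (h : EuclideanSpace ℝ (Fin 3)) =>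
      gradPin_of_hotPoint hUrate hUcont hUmild hUdiv hUhotbd hy h
    have hμ1' : μ (-1) (webMap e G (s, p.2) 2) ≠ 1 := by rw [hW2]; exact hμ1
    have hslope' : ∀ y : EuclideanSpace ℝ (Fin 3), y 2 = webMap e G (s, p.2) 2 →
        ∀ᶠ z in 𝓝 (((-1 : ℝ), y) : ℝ × EuclideanSpace ℝ (Fin 3)), ∀ b : Fin 3, b ≠ 2 →
          fderiv ℝ (U z.1) z.2 (EuclideanSpace.single 2 1) b = μ z.1 (z.2 2) * fderiv ℝ (U z.1) z.2 (EuclideanSpace.single b 1) 2 :=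
      fun y hy => hslope y (by rw [hy, hxx'])
    exact laplacian_two_eq_of_webData hUrate hUcont hUmild hUdiv hUpol hμ3 hm1 hxx' hslope' hμ1'
      (by rw [hs, hp'])
      (by rw [timePin_of_hotPoint hUrate hUcont hUmild hUdiv hUne hUhotbd hs, timePin_of_hotPoint hUrate hUcont hUmild hUdiv hUne hUhotbd hp'])
      (by rw [hg _ hs, hg _ hp']) (hg _ hs _) (hg _ hs _) (hg _ hp' _) (hg _ hp' _)
  -- differentiate the constant function `s ↦ Δθ(W(s,p₂))` at `s = p₁`
  have hΔd : DifferentiableAt ℝ (Δ θ) (webMap e G p) := differentiableAt_laplacian_of_contDiffAt hθ3.contDiffAt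
  have hcurve : HasDerivAt (fun s : ℝ => webMap e G (s, p.2)) e p.1 := by
    have hW : (fun s : ℝ => webMap e G (s, p.2)) = fun s : ℝ => s • e + (d p.2 • Jvec e + p.2 • e2) := by
      funext s; simp only [webMap, hG, add_assoc]
    rw [hW]
    have h := ((hasDerivAt_id p.1).smul_const e).add_const (d p.2 • Jvec e + p.2 • e2)
    simpa using h
  have hcomp : HasDerivAt (fun s : ℝ => (Δ θ) (webMap e G (s, p.2))) (fderiv ℝ (Δ θ) (webMap e G p) e) p.1 :=
    hΔd.hasFDerivAt.comp_hasDerivAt p.1 hcurve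
  have hconst : HasDerivAt (fun s : ℝ => (Δ θ) (webMap e G (s, p.2))) 0 p.1 := by
    have hev : (fun s : ℝ => (Δ θ) (webMap e G (s, p.2))) =ᶠ[𝓝 p.1] fun _ => (Δ θ) (webMap e G p) := hline
    exact (hasDerivAt_const p.1 _).congr_of_eventuallyEq hev
  exact hcomp.unique hconst

/-- ★★ **THE WEB DIRECTION KILLS THE THIRD DERIVATIVE ON THE STRAIGHT SONIC SHEET:** under the hypotheses of `sonic_sheet_laplacian_webDirection_eq_zero`
plus `e` a horizontal UNIT vector and `d` differentiable near `p₂`: `D³U₂(−1,·)(W p)[e][b][c] = 0` for all `b, c` — the horizontal derivative `∂_eU₂(−1,·)`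
vanishes on the sheet together with ALL its first and second derivatives. -/
theorem sonic_sheet_thirdDeriv_webDirection_eq_zero (hUrate : HasTypeITimeDecay C U) (hUcont : ContinuousOn (uncurry U) (Iio (0 : ℝ) ×ˢ univ))
    (hUmild : ∀ s t : ℝ, s < t → t < 0 → ∀ x, U t x = heatExtension (U s) (t - s) x - oseenDuhamel 1 s U U t x)
    (hUdiv : ∀ t < 0, VectorCalculus.IsDivFree (U t))
    (hUpol : ∀ s < 0, ∀ q, ⟪curl (U s) q, EuclideanSpace.single 2 1⟫_ℝ = 0)
    (hUne : U (-1) 0 2 ≠ 0) (hUhotbd : ∀ t < 0, ∀ x, Real.sqrt (-t) * |U t x 2| ≤ |U (-1) 0 2|)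
    (hσ : σ = 1 ∨ σ = -1) (hσN : σ * U (-1) 0 2 = |U (-1) 0 2|) (hΓhot : ∀ s, U (-1) (Γ s) 2 = U (-1) 0 2)
    (hr : 0 < r) (hδ : 0 < δ)
    (hweb : ∀ z₀ : ℝ, |z₀| < δ → ∀ s₀ : ℝ, ∃ n₀ ∈ Ioo (-r) r,
      σ * U (-1) (Γ s₀ + n₀ • νΓ s₀ + z₀ • EuclideanSpace.single 2 (1 : ℝ)) 2 = R 0 z₀ ∧
      (∀ n ∈ Icc (-r) r, n ≠ n₀ → σ * U (-1) (Γ s₀ + n • νΓ s₀ + z₀ • EuclideanSpace.single 2 (1 : ℝ)) 2 < R 0 z₀))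
    (hson : ∃ a b : ℝ, ∀ z : ℝ, |z| < δ → R 0 z = a + b * z)
    {ρ : ℝ} {μ : ℝ → ℝ → ℝ} (hρ : 0 < ρ) (hμ3 : ContDiff ℝ 3 (uncurry μ))
    (hslabU : ∀ t : ℝ, |t + 1| < ρ → ∀ x : EuclideanSpace ℝ (Fin 3), |x 2| < ρ → ∀ b : Fin 3, b ≠ 2 →
      fderiv ℝ (U t) x (EuclideanSpace.single 2 1) b = μ t (x 2) * fderiv ℝ (U t) x (EuclideanSpace.single b 1) 2)
    {e : EuclideanSpace ℝ (Fin 3)} (he2 : e 2 = 0) (hunit : e 0 ^ 2 + e 1 ^ 2 = 1) {d : ℝ → ℝ} {p : ℝ × ℝ}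
    (hd : ∀ᶠ z in 𝓝 p.2, DifferentiableAt ℝ d z) (hp : |p.2| < δ) (hpρ : |p.2| < ρ) (hμ1 : μ (-1) p.2 ≠ 1)
    (hGval : ∀ᶠ q in 𝓝 p, σ * U (-1) (webMap e (fun q : ℝ × ℝ => d q.2) q) 2 = R 0 q.2) (b c : EuclideanSpace ℝ (Fin 3)) :
    fderiv ℝ (fderiv ℝ (fderiv ℝ (fun x => U (-1) x 2))) (webMap e (fun q : ℝ × ℝ => d q.2) p) e b c = 0 := by
  have hm1 : (-1 : ℝ) < 0 := by norm_num
  set G : ℝ × ℝ → ℝ := fun q => d q.2 with hG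
  -- regularity
  have hUan : AnalyticOnNhd ℝ (U (-1)) univ := analyticOnNhd_slice hUcont (bdd_of_hasTypeITimeDecay hUrate) hUmild hm1
  have hθan : AnalyticOnNhd ℝ (fun y => U (-1) y 2) univ := fun x _ =>
    ((EuclideanSpace.proj (𝕜 := ℝ) (2 : Fin 3)).analyticAt _).comp (hUan x (mem_univ _))
  have hθ3 : ContDiff ℝ 3 (fun y => U (-1) y 2) := hθan.contDiff
  have hGd : ∀ q : ℝ × ℝ, DifferentiableAt ℝ d q.2 → DifferentiableAt ℝ G q :=
    fun q hq => (hq.hasDerivAt.hasFDerivAt.comp q hasFDerivAt_snd).differentiableAt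
  -- the web direction `e = DW(q)(1,0)` is null for the slice Hessian at every sheet point near `p` (`…SecondPins.sonic_sheet_hessian_tangent_eq_zero`)
  have hopen : ∀ᶠ q : ℝ × ℝ in 𝓝 p, |q.2| < δ :=
    (isOpen_lt (continuous_abs.comp continuous_snd) continuous_const).mem_nhds hp
  have hd' : ∀ᶠ q : ℝ × ℝ in 𝓝 p, DifferentiableAt ℝ d q.2 := continuousAt_snd.eventually hd
  have hnull : ∀ᶠ q in 𝓝 p, fderiv ℝ (fderiv ℝ (fun x => U (-1) x 2)) (webMap e G q) e = 0 := by
    filter_upwards [hd', hopen, hGval.eventually_nhds] with q hq hq2 hq'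
    have hGq : DifferentiableAt ℝ G q := hGd q hq
    have hfd : HasFDerivAt G ((ContinuousLinearMap.smulRight (1 : ℝ →L[ℝ] ℝ) (deriv d q.2)).comp (ContinuousLinearMap.snd ℝ ℝ ℝ)) q :=
      hq.hasDerivAt.hasFDerivAt.comp q hasFDerivAt_snd
    ext w
    have h := (sonic_sheet_hessian_tangent_eq_zero hUrate hUcont hUmild hUhotbd hσ hσN hΓhot hr hδ hweb hson e hq2 hGq hq' ((1 : ℝ), (0 : ℝ)) w).1
    rw [hfd.fderiv] at h
    simpa using h
  -- the Laplacian datum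
  have hlap := sonic_sheet_laplacian_webDirection_eq_zero hUrate hUcont hUmild hUdiv hUpol hUne hUhotbd hσ hσN hΓhot hr hδ hweb hson hρ hμ3
    hslabU he2 hp hpρ hμ1 hGval
  exact thirdDeriv_webDirection_eq_zero_of_null hθ3 he2 hunit hd.self_of_nhds hnull hlap b c

end Summit.NavierStokesRegularity.NavierStokesRegularity.Theorems.PoloidalWindowDoorLrcModEntireQ4SonicHotSheetJet

end
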